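import Summits.NavierStokesRegularity.NavierStokesRegularity.Theorems.EulerZoomLiouvillePowerGaugeEulerLiouvillePowerClockTameProfile

/-!
# Crux `EulerZoomLiouville.PowerGaugeEulerLiouville` (stmt-NavierStokesRegularity-19832), line `logtime-breathers` (T4):
# slice data of a CLASSICAL power clock about `T₀ ≥ 0` — the profile equation on every slice, slice pressures

Width seat `ns-ezl-w4` (power-clock rigidity, file I; the power-clock twin of `…BreatherProfile`).  A classical Euler pair `(u, p)` on
`(−∞,0) × ℝ³` with `u(τ, y) = (T₀−τ)^{γ−1} W((T₀−τ)^{−γ} y)` for all `τ < 0` (`T₀ ≥ 0`, any real `γ`) has, on EVERY slice `τ < 0`,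
the generalised profile equation `(1−γ) W + γ (z·∇)W + (W·∇)W + ∇P_τ = 0` with the slice pressure
`P_τ(z) = ((T₀−τ)^{γ−1})^{−2} p(τ, (T₀−τ)^{γ} z)` (`profile_equation`; `PowerClock.isSelfSimilarEulerProfile` is the slice `τ = −1`);
the slice pressures are smooth and differ by constants (`slicePressure_sub_eq`); `hasFDerivAt_slice` is the chain rule
`D(u(τ))(y) = (T₀−τ)^{−1} DW((T₀−τ)^{−γ} y)`.

WHAT THIS IS NOT: not NS regularity, not the crux — data bricks for the power-clock rigidity member (classical power clocks with
`γ > 1/(2+ρ)` about any `T₀ ≥ 0`); `--supports` stmt-19832. [folklore]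
-/

noncomputable section

set_option linter.dupNamespace false

open MeasureTheory Set Filter Topology Metric Function TopologicalSpace
open scoped ENNReal NNReal RealInnerProductSpace ContDiff

namespace Summit.NavierStokesRegularity.NavierStokesRegularity.Theorems.PowerGaugeEulerLiouville

open Literature.Analysis Literature.Analysis.FunctionSpaces Literature.Analysis.FluidPDE

namespace PowerClockRigidity

variable {u : ℝ → EuclideanSpace ℝ (Fin 3) → EuclideanSpace ℝ (Fin 3)} {p : ℝ → EuclideanSpace ℝ (Fin 3) → ℝ}
  {T₀ g : ℝ} {W : EuclideanSpace ℝ (Fin 3) → EuclideanSpace ℝ (Fin 3)}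

/-- The slice derivative of a power clock: `D(u(τ))(y) = (T₀−τ)^{−1} DW((T₀−τ)^{−γ} y)`. [folklore] -/
theorem hasFDerivAt_slice (hWd : Differentiable ℝ W) (hT₀ : 0 ≤ T₀)
    (hW : ∀ τ : ℝ, τ < 0 → ∀ y, u τ y = (T₀ - τ) ^ (g - 1) • W ((T₀ - τ) ^ (-g) • y))
    {τ : ℝ} (hτ : τ < 0) (y : EuclideanSpace ℝ (Fin 3)) :
    HasFDerivAt (u τ) ((T₀ - τ) ^ (-1 : ℝ) • fderiv ℝ W ((T₀ - τ) ^ (-g) • y)) y := by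
  have hs : 0 < T₀ - τ := by linarith
  have hus : u τ = fun y => (T₀ - τ) ^ (g - 1) • W ((T₀ - τ) ^ (-g) • y) := funext (hW τ hτ)
  rw [hus]
  have h1 : HasFDerivAt (fun y : EuclideanSpace ℝ (Fin 3) => (T₀ - τ) ^ (-g) • y)
      ((T₀ - τ) ^ (-g) • ContinuousLinearMap.id ℝ (EuclideanSpace ℝ (Fin 3))) y :=
    (ContinuousLinearMap.id ℝ (EuclideanSpace ℝ (Fin 3))).hasFDerivAt.const_smul ((T₀ - τ) ^ (-g))
  have h2 := ((hWd ((T₀ - τ) ^ (-g) • y)).hasFDerivAt.comp y h1).const_smul ((T₀ - τ) ^ (g - 1))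
  refine h2.congr_fderiv ?_
  ext v
  simp only [FunLike.coe_smul, Pi.smul_apply, ContinuousLinearMap.comp_apply, ContinuousLinearMap.id_apply,
    map_smul, smul_smul, ← Real.rpow_add hs, show g - 1 + -g = (-1 : ℝ) by ring]

/-- **THE POWER-CLOCK PROFILE EQUATION ON EVERY SLICE** (generalised profile equation with `(α, β) = (1−γ, γ)`).  For a classical
Euler pair with `u(τ, y) = (T₀−τ)^{γ−1} W((T₀−τ)^{−γ} y)` (`τ < 0`, `T₀ ≥ 0`) and every `τ < 0`:
`(1−γ) W(z) + γ DW(z)[z] + DW(z)[W z] + ∇P_τ(z) = 0`, `P_τ(y) = ((T₀−τ)^{γ−1})^{−2} p(τ, (T₀−τ)^{γ} y)`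
(`ClockRigidity.profile_identity` with `θ = (T₀−τ)^{γ−1}`, `ℓ = (T₀−τ)^{γ}`: `θ'ℓ/θ² = 1−γ`, `−ℓ'/θ = γ`). [folklore] -/
theorem profile_equation (hcl : IsClassicalEulerSolutionOn (Iio 0) 0 u p) (hT₀ : 0 ≤ T₀)
    (hW : ∀ τ : ℝ, τ < 0 → ∀ y, u τ y = (T₀ - τ) ^ (g - 1) • W ((T₀ - τ) ^ (-g) • y))
    {τ : ℝ} (hτ : τ < 0) (z : EuclideanSpace ℝ (Fin 3)) :
    (1 - g) • W z + g • fderiv ℝ W z z + fderiv ℝ W z (W z) +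
      gradient (fun y => (((T₀ - τ) ^ (g - 1)) ^ 2)⁻¹ * p τ ((T₀ - τ) ^ g • y)) z = 0 := by
  -- adapted from `PowerClock.isSelfSimilarEulerProfile` (…PowerClockTameProfile), slice `τ` instead of `−1`
  have hWd : Differentiable ℝ W := (PowerClock.contDiff_profile hcl hT₀ hW).differentiable (by norm_num)
  set θ : ℝ → ℝ := fun τ => (T₀ - τ) ^ (g - 1) with hθ
  set ℓ : ℝ → ℝ := fun τ => (T₀ - τ) ^ g with hℓ
  have hspos : ∀ τ : ℝ, τ < 0 → 0 < T₀ - τ := fun τ hτ => by linarith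
  have hpos : ∀ τ : ℝ, τ < 0 → 0 < θ τ ∧ 0 < ℓ τ := fun τ hτ =>
    ⟨Real.rpow_pos_of_pos (hspos τ hτ) _, Real.rpow_pos_of_pos (hspos τ hτ) _⟩
  have hθD : ∀ τ : ℝ, τ < 0 → HasDerivAt θ ((-1) * (g - 1) * (T₀ - τ) ^ (g - 1 - 1)) τ := fun τ hτ =>
    ((hasDerivAt_id τ).const_sub T₀).rpow_const (p := g - 1) (Or.inl (hspos τ hτ).ne')
  have hℓD : ∀ τ : ℝ, τ < 0 → HasDerivAt ℓ ((-1) * g * (T₀ - τ) ^ (g - 1)) τ := fun τ hτ =>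
    ((hasDerivAt_id τ).const_sub T₀).rpow_const (p := g) (Or.inl (hspos τ hτ).ne')
  have hθd : DifferentiableOn ℝ θ (Iio 0) := fun τ hτ => (hθD τ hτ).differentiableAt.differentiableWithinAt
  have hℓd : DifferentiableOn ℝ ℓ (Iio 0) := fun τ hτ => (hℓD τ hτ).differentiableAt.differentiableWithinAt
  have hu : ∀ τ : ℝ, τ < 0 → ∀ y, u τ y = θ τ • W ((ℓ τ)⁻¹ • y) := by
    intro τ hτ y
    rw [hW τ hτ y, hθ, hℓ, Real.rpow_neg (hspos τ hτ).le]
  have hs : 0 < T₀ - τ := hspos τ hτ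
  set A : ℝ := (T₀ - τ) ^ (g - 1) with hA
  have hA0 : A ≠ 0 := (Real.rpow_pos_of_pos hs _).ne'
  have hθ1 : θ τ = A := by simp only [hθ, hA]
  have hℓ1 : ℓ τ = (T₀ - τ) ^ g := by simp only [hℓ]
  have hℓA : ℓ τ = (T₀ - τ) * A := by
    have h := Real.rpow_add hs 1 (g - 1)
    rw [show (1 : ℝ) + (g - 1) = g by ring, Real.rpow_one] at h
    rw [hℓ1, hA, h]
  have hdθ : deriv θ τ = (1 - g) * A / (T₀ - τ) := by
    rw [(hθD τ hτ).deriv, Real.rpow_sub_one hs.ne' (g - 1), ← hA]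
    ring
  have hdℓ : deriv ℓ τ = -(g * A) := by
    rw [(hℓD τ hτ).deriv, ← hA]
    ring
  have hid := ClockRigidity.profile_identity hcl hpos hθd hℓd hu hWd hτ z
  have hc1 : deriv θ τ * ℓ τ / θ τ ^ 2 = 1 - g := by
    rw [hdθ, hℓA, hθ1]; field_simp
  have hc2 : -(deriv ℓ τ / θ τ) = g := by
    rw [hdℓ, hθ1]; field_simp
  have hpd : DifferentiableAt ℝ (fun y => p τ ((T₀ - τ) ^ g • y)) z := by
    have hpD : Differentiable ℝ (p τ) := (hcl.contDiff_pressure hτ).differentiable (by simp)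
    have : Differentiable ℝ (fun y : EuclideanSpace ℝ (Fin 3) => p τ ((T₀ - τ) ^ g • y)) := by fun_prop
    exact this z
  rw [hc1, hc2, hθ1, hℓ1, ClockRigidity.gradient_const_mul' hpd] at hid
  rw [ClockRigidity.gradient_const_mul' hpd, hid, neg_smul, neg_add_cancel]

/-- The slice pressures `P_τ(y) = ((T₀−τ)^{γ−1})^{−2} p(τ, (T₀−τ)^{γ} y)` of a classical power clock are smooth (`τ < 0`). [folklore] -/
theorem contDiff_slicePressure (hcl : IsClassicalEulerSolutionOn (Iio 0) 0 u p) {τ : ℝ} (hτ : τ < 0) :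
    ContDiff ℝ ∞ (fun y => (((T₀ - τ) ^ (g - 1)) ^ 2)⁻¹ * p τ ((T₀ - τ) ^ g • y)) :=
  contDiff_const.mul ((hcl.contDiff_pressure hτ).comp (contDiff_const_smul _))

/-- **The slice pressures differ by constants**: `P_τ(z) − P_{τ'}(z) = P_τ(0) − P_{τ'}(0)` for all `τ, τ' < 0` and `z`
(both have the gradient `−((1−γ)W + γ(z·∇)W + (W·∇)W)`). [folklore] -/
theorem slicePressure_sub_eq (hcl : IsClassicalEulerSolutionOn (Iio 0) 0 u p) (hT₀ : 0 ≤ T₀)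
    (hW : ∀ τ : ℝ, τ < 0 → ∀ y, u τ y = (T₀ - τ) ^ (g - 1) • W ((T₀ - τ) ^ (-g) • y))
    {τ τ' : ℝ} (hτ : τ < 0) (hτ' : τ' < 0) (z : EuclideanSpace ℝ (Fin 3)) :
    (((T₀ - τ) ^ (g - 1)) ^ 2)⁻¹ * p τ ((T₀ - τ) ^ g • z) - (((T₀ - τ') ^ (g - 1)) ^ 2)⁻¹ * p τ' ((T₀ - τ') ^ g • z) =
      (((T₀ - τ) ^ (g - 1)) ^ 2)⁻¹ * p τ ((T₀ - τ) ^ g • 0) -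
        (((T₀ - τ') ^ (g - 1)) ^ 2)⁻¹ * p τ' ((T₀ - τ') ^ g • 0) := by
  -- adapted from `BreatherRigidity.slicePressure_sub_eq`
  set f : EuclideanSpace ℝ (Fin 3) → ℝ := fun y => (((T₀ - τ) ^ (g - 1)) ^ 2)⁻¹ * p τ ((T₀ - τ) ^ g • y) -
    (((T₀ - τ') ^ (g - 1)) ^ 2)⁻¹ * p τ' ((T₀ - τ') ^ g • y) with hf
  have hd1 : Differentiable ℝ (fun y => (((T₀ - τ) ^ (g - 1)) ^ 2)⁻¹ * p τ ((T₀ - τ) ^ g • y)) :=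
    (contDiff_slicePressure hcl hτ).differentiable (by simp)
  have hd2 : Differentiable ℝ (fun y => (((T₀ - τ') ^ (g - 1)) ^ 2)⁻¹ * p τ' ((T₀ - τ') ^ g • y)) :=
    (contDiff_slicePressure hcl hτ').differentiable (by simp)
  have hfd : Differentiable ℝ f := hd1.sub hd2
  have hgrad : ∀ y, gradient f y = 0 := by
    intro y
    have e1 := profile_equation hcl hT₀ hW hτ y
    have e2 := profile_equation hcl hT₀ hW hτ' y
    have hsub : gradient f y = gradient (fun y => (((T₀ - τ) ^ (g - 1)) ^ 2)⁻¹ * p τ ((T₀ - τ) ^ g • y)) y -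
        gradient (fun y => (((T₀ - τ') ^ (g - 1)) ^ 2)⁻¹ * p τ' ((T₀ - τ') ^ g • y)) y := by
      rw [hf]
      unfold gradient
      rw [fderiv_fun_sub (hd1 y) (hd2 y), map_sub]
    rw [hsub]
    have : gradient (fun y => (((T₀ - τ) ^ (g - 1)) ^ 2)⁻¹ * p τ ((T₀ - τ) ^ g • y)) y =
        gradient (fun y => (((T₀ - τ') ^ (g - 1)) ^ 2)⁻¹ * p τ' ((T₀ - τ') ^ g • y)) y := by
      have h1 := eq_neg_of_add_eq_zero_right e1
      have h2 := eq_neg_of_add_eq_zero_right e2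
      rw [h1, h2]
    rw [this, sub_self]
  have hfderiv : ∀ y, fderiv ℝ f y = 0 := fun y => by
    rw [← toDual_gradient (𝕜 := ℝ), hgrad y, map_zero]
  exact is_const_of_fderiv_eq_zero hfd hfderiv z 0

end PowerClockRigidity

end Summit.NavierStokesRegularity.NavierStokesRegularity.Theorems.PowerGaugeEulerLiouville

end
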